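import Mathlib
import HarnessLib
import Summits.QuantumAdvantage.QuantumAdvantage.Theses.RegulatorThird

/-!
# Birth skeleton — piece `LeastDenominatorFP` of the `OneThirdFP` split (stmt-QuantumAdvantage-15982)

The only visible line for the exposed core: the optimal ambiguous class is SHALLOW (every prime of the denominator
`n*` is either `≤ polylog s` — trial-divisible — or lies above a PRINCIPAL ambiguous ideal — the one at distance `R/2`,
reachable from `r`), and under shallowness `n*` is `FP`-computable (trial division + the `R/2` ambiguous ideal give the
candidate ideals `𝔟`; walk each class `[𝔟]` to the 3-division targets, compare keys).  `stub_shallowOptimalClass` is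
heuristically FALSE for large `s` (a `≍ b^{-1/3}`-fraction of the `s` ramified at a deep prime `b` should have their
least representative in `[(b, √s)]`; observed depth grows: `b = 7` non-principal at `s = 385`,
`Cruxes/OneThirdFP/SPLIT-RATIONALE.md` §2) — it is the piece's CHEAPEST FALSIFIER: a refuter computes, for `s` up to
`10^6`, the class-`[𝔟]` optima directly along the ambiguous cycles (polynomial per `s`, one kit job) and looks for a
non-principal optimal `𝔟` with a prime `> (log₂ s + 2)^c`.  Its death is the signal to restate THIRD over integral
representatives (route kill criterion (iii)).
-/

set_option linter.dupNamespace false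

namespace Summit.QuantumAdvantage.QuantumAdvantage.Cruxes.OneThirdFP.BirthLeastDenominatorFP

/-- Membership of `(A + B√s)/n` in `η K^{×3} ∪ η⁻¹ K^{×3}` — verbatim the route's inlined clause. -/
def IsRep (s : ℕ) (A B : ℤ) (n : ℕ) : Prop :=
  (0 < n ∧ ∀ (K : Type) [Field K] [NumberField K], Module.finrank ℚ K = 2 → ∀ α : K, α ^ 2 = (s : K) → ∀ u : (NumberField.RingOfIntegers K)ˣ, (∀ v : (NumberField.RingOfIntegers K)ˣ, ∃ m : ℤ, v = u ^ m ∨ v = -(u ^ m)) → ∃ z : K, z ≠ 0 ∧ (((A : K) + (B : K) * α) / (n : K) = ((u : NumberField.RingOfIntegers K) : K) * z ^ 3 ∨ ((A : K) + (B : K) * α) / (n : K) = ((u⁻¹ : (NumberField.RingOfIntegers K)ˣ) : NumberField.RingOfIntegers K) * z ^ 3))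

/-- The key-then-lexicographic order clause of the route, verbatim. -/
def KeyLE (A B : ℤ) (n : ℕ) (A' B' : ℤ) (n' : ℕ) : Prop :=
  (|A| + |B| + n < |A'| + |B'| + n' ∨ (|A| + |B| + n = |A'| + |B'| + n' ∧ (A < A' ∨ (A = A' ∧ (B < B' ∨ (B = B' ∧ n ≤ n'))))))

/-- `(A, B, n)` is the LEAST representative — verbatim the route's inlined conjunction. -/
def IsLeast (s : ℕ) (A B : ℤ) (n : ℕ) : Prop :=
  IsRep s A B n ∧ ∀ (A' B' : ℤ) (n' : ℕ), IsRep s A' B' n' → KeyLE A B n A' B' n'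

/-- The route's code of a triple. -/
def code (A B : ℤ) (n : ℕ) : List Bool :=
  Literature.Computability.Complexity.boolPair (Literature.Computability.Complexity.boolPair (Computability.encodeNat A.natAbs) (Computability.encodeNat B.natAbs)) (Literature.Computability.Complexity.boolPair (Computability.encodeNat n) [decide (A < 0), decide (B < 0)])

/-- STUB (arithmetic, killable): the optimal denominator is shallow — each of its primes is polylog-small or
principal-ambiguous (an element of norm `±p` or `±4p` exists). -/
theorem stub_shallowOptimalClass :
    ∃ c : ℕ, ∀ (s : ℕ), Squarefree s → 1 < s → ∀ (A B : ℤ) (n : ℕ), IsLeast s A B n → ∀ p : ℕ, Nat.Prime p → p ∣ n → (p ≤ (Nat.log 2 s + 2) ^ c ∨ ∃ a b : ℤ, (a ^ 2 - (s : ℤ) * b ^ 2 = p ∨ a ^ 2 - (s : ℤ) * b ^ 2 = -(p : ℤ) ∨ a ^ 2 - (s : ℤ) * b ^ 2 = 4 * p ∨ a ^ 2 - (s : ℤ) * b ^ 2 = -(4 * (p : ℤ)))) := by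
  sorry

/-- STUB (algorithmic, XL): under shallowness the denominator of the least representative is `FP`-computable from
`⟨bin s, bin r⟩` (trial division to `(log₂ s + 2)^c`, the ambiguous ideal at distance `R/2` from `r` by giant steps
(Cohen 1993 Prop. 8.7.1), then per candidate `𝔟` the class-`[𝔟]` optimum by the infrastructure walk of the sibling
piece, exact keys compared). -/
theorem stub_denominatorFromShallowFP :
    (∃ c : ℕ, ∀ (s : ℕ), Squarefree s → 1 < s → ∀ (A B : ℤ) (n : ℕ), IsLeast s A B n → ∀ p : ℕ, Nat.Prime p → p ∣ n → (p ≤ (Nat.log 2 s + 2) ^ c ∨ ∃ a b : ℤ, (a ^ 2 - (s : ℤ) * b ^ 2 = p ∨ a ^ 2 - (s : ℤ) * b ^ 2 = -(p : ℤ) ∨ a ^ 2 - (s : ℤ) * b ^ 2 = 4 * p ∨ a ^ 2 - (s : ℤ) * b ^ 2 = -(4 * (p : ℤ))))) →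
    (∃ f ∈ Literature.Computability.Complexity.FP, ∀ (s r : ℕ), Squarefree s → 1 < s → (∀ (K : Type) [Field K] [NumberField K], Module.finrank ℚ K = 2 → (∃ α : K, α ^ 2 = (s : K)) → |NumberField.Units.regulator K - (r : ℝ)| ≤ 1) → ∀ (A B : ℤ) (n : ℕ), ((0 < n ∧ ∀ (K : Type) [Field K] [NumberField K], Module.finrank ℚ K = 2 → ∀ α : K, α ^ 2 = (s : K) → ∀ u : (NumberField.RingOfIntegers K)ˣ, (∀ v : (NumberField.RingOfIntegers K)ˣ, ∃ m : ℤ, v = u ^ m ∨ v = -(u ^ m)) → ∃ z : K, z ≠ 0 ∧ (((A : K) + (B : K) * α) / (n : K) = ((u : NumberField.RingOfIntegers K) : K) * z ^ 3 ∨ ((A : K) + (B : K) * α) / (n : K) = ((u⁻¹ : (NumberField.RingOfIntegers K)ˣ) : NumberField.RingOfIntegers K) * z ^ 3)) ∧ ∀ (A' B' : ℤ) (n' : ℕ), (0 < n' ∧ ∀ (K : Type) [Field K] [NumberField K], Module.finrank ℚ K = 2 → ∀ α : K, α ^ 2 = (s : K) → ∀ u : (NumberField.RingOfIntegers K)ˣ,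 (∀ v : (NumberField.RingOfIntegers K)ˣ, ∃ m : ℤ, v = u ^ m ∨ v = -(u ^ m)) → ∃ z : K, z ≠ 0 ∧ (((A' : K) + (B' : K) * α) / (n' : K) = ((u : NumberField.RingOfIntegers K) : K) * z ^ 3 ∨ ((A' : K) + (B' : K) * α) / (n' : K) = ((u⁻¹ : (NumberField.RingOfIntegers K)ˣ) : NumberField.RingOfIntegers K) * z ^ 3)) → (|A| + |B| + n < |A'| + |B'| + n' ∨ (|A| + |B| + n = |A'| + |B'| + n' ∧ (A < A' ∨ (A = A' ∧ (B < B' ∨ (B = B' ∧ n ≤ n'))))))) → f (Literature.Computability.Complexity.boolPair (Computability.encodeNat s) (Computability.encodeNat r)) = Computability.encodeNat n) := by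
  sorry

/-- Composition: the two stubs give the piece `LeastDenominatorFP` (statement verbatim as filed). -/
theorem leastDenominatorFP_of
    (h₁ : ∃ c : ℕ, ∀ (s : ℕ), Squarefree s → 1 < s → ∀ (A B : ℤ) (n : ℕ), IsLeast s A B n → ∀ p : ℕ, Nat.Prime p → p ∣ n → (p ≤ (Nat.log 2 s + 2) ^ c ∨ ∃ a b : ℤ, (a ^ 2 - (s : ℤ) * b ^ 2 = p ∨ a ^ 2 - (s : ℤ) * b ^ 2 = -(p : ℤ) ∨ a ^ 2 - (s : ℤ) * b ^ 2 = 4 * p ∨ a ^ 2 - (s : ℤ) * b ^ 2 = -(4 * (p : ℤ)))))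
    (h₂ : (∃ c : ℕ, ∀ (s : ℕ), Squarefree s → 1 < s → ∀ (A B : ℤ) (n : ℕ), IsLeast s A B n → ∀ p : ℕ, Nat.Prime p → p ∣ n → (p ≤ (Nat.log 2 s + 2) ^ c ∨ ∃ a b : ℤ, (a ^ 2 - (s : ℤ) * b ^ 2 = p ∨ a ^ 2 - (s : ℤ) * b ^ 2 = -(p : ℤ) ∨ a ^ 2 - (s : ℤ) * b ^ 2 = 4 * p ∨ a ^ 2 - (s : ℤ) * b ^ 2 = -(4 * (p : ℤ))))) → (∃ f ∈ Literature.Computability.Complexity.FP, ∀ (s r : ℕ), Squarefree s → 1 < s → (∀ (K : Type) [Field K] [NumberField K], Module.finrank ℚ K = 2 → (∃ α : K, α ^ 2 = (s : K)) → |NumberField.Units.regulator K - (r : ℝ)| ≤ 1) → ∀ (A B : ℤ) (n : ℕ), ((0 < n ∧ ∀ (K : Type) [Field K] [NumberField K], Module.finrank ℚ K = 2 → ∀ α : K, α ^ 2 = (s : K) → ∀ u : (NumberField.RingOfIntegers K)ˣ, (∀ v : (NumberField.RingOfIntegers K)ˣ, ∃ m : ℤ, v = u ^ m ∨ v = -(u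 ^ m)) → ∃ z : K, z ≠ 0 ∧ (((A : K) + (B : K) * α) / (n : K) = ((u : NumberField.RingOfIntegers K) : K) * z ^ 3 ∨ ((A : K) + (B : K) * α) / (n : K) = ((u⁻¹ : (NumberField.RingOfIntegers K)ˣ) : NumberField.RingOfIntegers K) * z ^ 3)) ∧ ∀ (A' B' : ℤ) (n' : ℕ), (0 < n' ∧ ∀ (K : Type) [Field K] [NumberField K], Module.finrank ℚ K = 2 → ∀ α : K, α ^ 2 = (s : K) → ∀ u : (NumberField.RingOfIntegers K)ˣ, (∀ v : (NumberField.RingOfIntegers K)ˣ, ∃ m : ℤ, v = u ^ m ∨ v = -(u ^ m)) → ∃ z : K, z ≠ 0 ∧ (((A' : K) + (B' : K) * α) / (n' : K) = ((u : NumberField.RingOfIntegers K) : K) * z ^ 3 ∨ ((A' : K) + (B' : K) * α) / (n' : K) = ((u⁻¹ : (NumberField.RingOfIntegers K)ˣ) : NumberField.RingOfIntegers K) * z ^ 3)) → (|A| + |B| + n < |A'| + |B'| + n' ∨ (|A| + |B| + n = |A'| + |B'| + n' ∧ (A < A' ∨ (A = A' ∧ (B < B' ∨ (B = B' ∧ n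 ≤ n'))))))) → f (Literature.Computability.Complexity.boolPair (Computability.encodeNat s) (Computability.encodeNat r)) = Computability.encodeNat n)) :
    ∃ f ∈ Literature.Computability.Complexity.FP, ∀ (s r : ℕ), Squarefree s → 1 < s → (∀ (K : Type) [Field K] [NumberField K], Module.finrank ℚ K = 2 → (∃ α : K, α ^ 2 = (s : K)) → |NumberField.Units.regulator K - (r : ℝ)| ≤ 1) → ∀ (A B : ℤ) (n : ℕ), ((0 < n ∧ ∀ (K : Type) [Field K] [NumberField K], Module.finrank ℚ K = 2 → ∀ α : K, α ^ 2 = (s : K) → ∀ u : (NumberField.RingOfIntegers K)ˣ, (∀ v : (NumberField.RingOfIntegers K)ˣ, ∃ m : ℤ, v = u ^ m ∨ v = -(u ^ m)) → ∃ z : K, z ≠ 0 ∧ (((A : K) + (B : K) * α) / (n : K) = ((u : NumberField.RingOfIntegers K) : K) * z ^ 3 ∨ ((A : K) + (B : K) * α) / (n : K) = ((u⁻¹ : (NumberField.RingOfIntegers K)ˣ) : NumberField.RingOfIntegers K) * z ^ 3)) ∧ ∀ (A' B' : ℤ) (n' : ℕ), (0 < n' ∧ ∀ (K : Type) [Field K]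 [NumberField K], Module.finrank ℚ K = 2 → ∀ α : K, α ^ 2 = (s : K) → ∀ u : (NumberField.RingOfIntegers K)ˣ, (∀ v : (NumberField.RingOfIntegers K)ˣ, ∃ m : ℤ, v = u ^ m ∨ v = -(u ^ m)) → ∃ z : K, z ≠ 0 ∧ (((A' : K) + (B' : K) * α) / (n' : K) = ((u : NumberField.RingOfIntegers K) : K) * z ^ 3 ∨ ((A' : K) + (B' : K) * α) / (n' : K) = ((u⁻¹ : (NumberField.RingOfIntegers K)ˣ) : NumberField.RingOfIntegers K) * z ^ 3)) → (|A| + |B| + n < |A'| + |B'| + n' ∨ (|A| + |B| + n = |A'| + |B'| + n' ∧ (A < A' ∨ (A = A' ∧ (B < B' ∨ (B = B' ∧ n ≤ n'))))))) → f (Literature.Computability.Complexity.boolPair (Computability.encodeNat s) (Computability.encodeNat r)) = Computability.encodeNat n :=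
  h₂ h₁

/-- Sanity: `IsLeast` is by definition the route's inlined least-representative clause. -/
example (s : ℕ) (A B : ℤ) (n : ℕ) : IsLeast s A B n ↔ ((0 < n ∧ ∀ (K : Type) [Field K] [NumberField K], Module.finrank ℚ K = 2 → ∀ α : K, α ^ 2 = (s : K) → ∀ u : (NumberField.RingOfIntegers K)ˣ, (∀ v : (NumberField.RingOfIntegers K)ˣ, ∃ m : ℤ, v = u ^ m ∨ v = -(u ^ m)) → ∃ z : K, z ≠ 0 ∧ (((A : K) + (B : K) * α) / (n : K) = ((u : NumberField.RingOfIntegers K) : K) * z ^ 3 ∨ ((A : K) + (B : K) * α) / (n : K) = ((u⁻¹ : (NumberField.RingOfIntegers K)ˣ) : NumberField.RingOfIntegers K) * z ^ 3)) ∧ ∀ (A' B' : ℤ) (n' : ℕ), (0 < n' ∧ ∀ (K : Type) [Field K] [NumberField K], Module.finrank ℚ K = 2 → ∀ α : K, α ^ 2 = (s : K) → ∀ u : (NumberField.RingOfIntegers K)ˣ, (∀ v : (NumberField.RingOfIntegers K)ˣ, ∃ m : ℤ, v = u ^ m ∨ v = -(u ^ m)) → ∃ z : K, z ≠ 0 ∧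 (((A' : K) + (B' : K) * α) / (n' : K) = ((u : NumberField.RingOfIntegers K) : K) * z ^ 3 ∨ ((A' : K) + (B' : K) * α) / (n' : K) = ((u⁻¹ : (NumberField.RingOfIntegers K)ˣ) : NumberField.RingOfIntegers K) * z ^ 3)) → (|A| + |B| + n < |A'| + |B'| + n' ∨ (|A| + |B| + n = |A'| + |B'| + n' ∧ (A < A' ∨ (A = A' ∧ (B < B' ∨ (B = B' ∧ n ≤ n'))))))) := Iff.rfl

end Summit.QuantumAdvantage.QuantumAdvantage.Cruxes.OneThirdFP.BirthLeastDenominatorFP
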